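import Mathlib.Algebra.BigOperators.Fin
import Mathlib.Algebra.Group.Subgroup.Defs
import Mathlib.Data.Fintype.Card
import Mathlib.Logic.Equiv.Basic
import Mathlib.Order.ConditionallyCompleteLattice.Basic
import Literature.Computability.Complexity.CircuitSemantics
import Literature.Computability.Complexity.ConstantDepth
import HarnessLib

/-!
# Symmetric Boolean circuits (Anderson–Dawar; Dawar–Wilsenach)

A Boolean circuit whose inputs are indexed by a set `ι` carrying an action of a permutation group
`Γ` is **`Γ`-symmetric** if every `π ∈ Γ`, applied to the input variables, extends to an
automorphism of the circuit: a relabelling of the gates that fixes the output, preserves gate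
labels, and carries the wiring onto itself (Anderson–Dawar, *On symmetric circuits and
fixed-point logics*, Theory Comput. Syst. 60 (2017), Def. 6 "induced automorphism", Def. 7
"symmetric"; Dawar–Wilsenach, *Symmetric arithmetic circuits*, Theory of Computing 21 (2025),
Def. 3.6 "automorphism extending `π`", Def. 3.7 "`Γ`-symmetric circuit" for an arbitrary
`Γ ≤ Sym(X)`). Anderson–Dawar take inputs indexed by tuples of an `n`-element universe with
`Sym_n` acting diagonally; Dawar–Wilsenach call the diagonal case on `V × V` *square-symmetric*.

This file phrases these notions for the tree's straight-line circuits
`Literature.Computability.Complexity.Circuit ι` (`Circuit.lean`: a list of gates, gate `j` reading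
inputs `Sum.inl i` or earlier gates `Sum.inr m`, one output wire):

* `GateFn.IsSymmetric` — a gate function whose value depends only on the number of ones
  (Anderson–Dawar 2017, §2.2); all gates of `acBasis`, `accBasis m`, `tcBasis` are symmetric, and
  the notion is equivalent to invariance under permuting the arguments
  (`GateFn.isSymmetric_iff_forall_perm`, Dawar–Wilsenach 2025, Def. 3.2 "fully symmetric").
* `Circuit.IsInducedAut C π σ` — the gate permutation `σ` is an automorphism of `C` extending the
  map `π` of input variables: with the induced relabelling of wires
  `Circuit.relabelWire π σ = Sum.map π (Circuit.relabelGate σ)`, the output wire is fixed, gate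
  `σ j` has the same gate function as gate `j`, and the argument list of gate `σ j` is a
  permutation of the relabelled argument list of gate `j` (the multiset of children is carried
  over — the straight-line rendering of "`W(g,h)` iff `W(πg,πh)`" and "`σΛ(g) = Λ(πg)`").
* `Circuit.IsVarSymmetric Γ C` for `Γ : Set (Equiv.Perm ι)` — Dawar–Wilsenach's `Γ`-symmetric
  circuits (the group acts on the variables themselves).
* `Circuit.IsSymmetricUnder Γ C` for `Γ : Set (Equiv.Perm (Fin m))` and
  `C : Circuit (Fin m × Fin m)` — the **matrix (square) case**: `ρ ∈ Γ` acts on the input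
  `(u, v)` by `(ρ u, ρ v)`. This is, *verbatim*, the inline predicate `Sym` of the route
  `Summits/PneNP/PneNP/Theses/SymmetryBudget.lean` (`Circuit.isSymmetricUnder_iff` is `Iff.rfl`),
  and `HasSymCircuit B Γ s f` is verbatim its `HasSym` with the basis as a parameter.
* `symCircuitSizeOver B Γ f` — least size of a `Γ`-symmetric circuit over `B` computing `f`
  (junk value `0` if there is none, exactly as `circuitSizeOver`).
* `pointStabiliserBudget m g` — the permutations of `Fin m` fixing every `i` with `i + g < m`
  (the pointwise stabiliser of the first `m - g` points; a subgroup, `budgetSubgroup`).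
* `Circuit.IsRigid` — Dawar–Wilsenach's rigidity (every `π` has at most one extension), kept as a
  SEPARATE predicate; it is not part of symmetry (nor is Anderson–Dawar's syntactic Def. 8).
* `SymmetricCircuit m B Γ` — the bundled form: a circuit on `m × m` matrix inputs together with
  `IsOver B` and `IsSymmetricUnder Γ` (`hasSymCircuit_iff` relates it to `HasSymCircuit`).

Main theorem (Anderson–Dawar 2017, §2.2, "symmetry implies invariance"; Dawar–Wilsenach 2025,
after Def. 3.7): if `σ` is an automorphism of `C` extending `π` and every gate of `C` is a
symmetric gate function, then `C.eval (x ∘ π) = C.eval x` (`Circuit.IsInducedAut.eval_comp_eq`);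
hence a `Γ`-symmetric circuit over `tcBasis` computes a `Γ`-invariant function
(`Circuit.IsSymmetricUnder.eval_comp_eq`, `Circuit.IsSymmetricUnder.invariant_of_computes`).
The proof is the induction along the program order suggested by the well-formedness of
straight-line programs: the value of gate `σ j` on `x` equals the value of gate `j` on `x ∘ π`.

Not here (deliberately): the symmetrisation construction (`|Γ|` relabelled copies and one `∧`
gate), supports and the support theorem (Dawar–Wilsenach 2025, Def. 6.1, Thm. 6.2), uniformity.
Mathlib has no Boolean circuits (`lean search`: only `Matroid.IsCircuit`, `SimpleGraph.Walk.IsCircuit`).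
-/

namespace Literature.Computability.Complexity

open Finset

/-! ### Symmetric gate functions -/

namespace GateFn

/-- A gate function `f` (an arity `k` with a truth table on `Fin k → Bool`) is **symmetric** if
its value depends only on the number of ones among its arguments: `f v = f w` whenever `v` and
`w` have the same number of ones (Anderson–Dawar 2017, §2.2: "bases containing symmetric
functions, i.e. … `f(x) = f(y)` for all `x, y ∈ {0,1}ⁿ` with the same number of ones").
Equivalent to invariance under all permutations of the arguments
(`GateFn.isSymmetric_iff_forall_perm`). [cite: AndersonDawar2016, §2.2] -/
def IsSymmetric (f : GateFn) : Prop :=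
  ∀ v w : Fin f.1 → Bool, numOnes v = numOnes w → f.2 v = f.2 w

/-- Permuting the arguments does not change the number of ones. [folklore] -/
theorem numOnes_comp_perm {k : ℕ} (v : Fin k → Bool) (π : Equiv.Perm (Fin k)) :
    numOnes (v ∘ π) = numOnes v := by
  unfold numOnes
  refine Finset.card_bij (fun i _ => π i) (fun a ha => ?_) (fun a₁ _ a₂ _ h => π.injective h)
    (fun b hb => ⟨π.symm b, ?_, by simp⟩)
  · simpa using ha
  · simpa using hb

/-- A symmetric gate function is invariant under permuting its arguments (Dawar–Wilsenach 2025,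
Def. 3.2: the "fully symmetric" functions). [cite: DawarWilsenach2025, Def. 3.2] -/
theorem IsSymmetric.comp_perm {f : GateFn} (hf : f.IsSymmetric) (π : Equiv.Perm (Fin f.1))
    (v : Fin f.1 → Bool) : f.2 (v ∘ π) = f.2 v :=
  hf _ _ (numOnes_comp_perm v π)

/-- Two Boolean tuples with the same number of ones differ by a permutation of the positions.
[folklore] -/
theorem exists_perm_comp_eq_of_numOnes_eq {k : ℕ} {v w : Fin k → Bool}
    (h : numOnes v = numOnes w) : ∃ π : Equiv.Perm (Fin k), v ∘ π = w := by
  classical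
  have h1 : Fintype.card {i // w i = true} = Fintype.card {i // v i = true} := by
    rw [Fintype.card_subtype, Fintype.card_subtype]
    exact h.symm
  have h0 : Fintype.card {i // ¬w i = true} = Fintype.card {i // ¬v i = true} := by
    rw [Fintype.card_subtype_compl, Fintype.card_subtype_compl, h1]
  refine ⟨Equiv.subtypeCongr (Fintype.equivOfCardEq h1) (Fintype.equivOfCardEq h0),
    funext fun i => ?_⟩
  by_cases hi : w i = true
  · have hval : Equiv.subtypeCongr (Fintype.equivOfCardEq h1) (Fintype.equivOfCardEq h0) i =
        (Fintype.equivOfCardEq h1 ⟨i, hi⟩ : Fin k) := by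
      simp only [Equiv.subtypeCongr, Equiv.trans_apply, Equiv.sumCongr_apply]
      rw [Equiv.sumCompl_symm_apply_of_pos (p := fun x => w x = true) hi]
      rfl
    rw [Function.comp_apply, hval, hi]
    exact (Fintype.equivOfCardEq h1 ⟨i, hi⟩).2
  · have hval : Equiv.subtypeCongr (Fintype.equivOfCardEq h1) (Fintype.equivOfCardEq h0) i =
        (Fintype.equivOfCardEq h0 ⟨i, hi⟩ : Fin k) := by
      simp only [Equiv.subtypeCongr, Equiv.trans_apply, Equiv.sumCongr_apply]
      rw [Equiv.sumCompl_symm_apply_of_neg (p := fun x => w x = true) hi]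
      rfl
    rw [Function.comp_apply, hval, Bool.eq_false_iff.2 hi]
    exact Bool.eq_false_iff.2 (Fintype.equivOfCardEq h0 ⟨i, hi⟩).2

/-- Anderson–Dawar's symmetric gate functions (value determined by the number of ones) are exactly
the gate functions invariant under every permutation of the arguments (Dawar–Wilsenach 2025,
Def. 3.1–3.2 with `Γ = Sym(Fin k)`). [cite: DawarWilsenach2025, Def. 3.1–3.2] -/
theorem isSymmetric_iff_forall_perm (f : GateFn) :
    f.IsSymmetric ↔ ∀ (π : Equiv.Perm (Fin f.1)) (v : Fin f.1 → Bool), f.2 (v ∘ π) = f.2 v := by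
  refine ⟨fun hf π v => hf.comp_perm π v, fun h v w hvw => ?_⟩
  obtain ⟨π, rfl⟩ := exists_perm_comp_eq_of_numOnes_eq hvw
  exact (h π v).symm

/-- A gate whose truth table is a function of the number of ones is symmetric (by definition).
[cite: AndersonDawar2016, §2.2] -/
theorem isSymmetric_of_numOnes (k : ℕ) (t : ℕ → Bool) :
    IsSymmetric ⟨k, fun v => t (numOnes v)⟩ := fun v w h => by
  show t (numOnes v) = t (numOnes w)
  rw [h]

/-- All arguments are `true` iff the number of ones is the arity. [folklore] -/
theorem forall_eq_true_iff_numOnes_eq {k : ℕ} (v : Fin k → Bool) :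
    (∀ i, v i = true) ↔ numOnes v = k := by
  unfold numOnes
  constructor
  · intro h
    rw [Finset.filter_true_of_mem fun i _ => h i, card_univ, Fintype.card_fin]
  · intro h i
    have huniv : (univ.filter fun i => v i = true) = univ :=
      Finset.eq_univ_of_card _ (by rw [h, Fintype.card_fin])
    exact (Finset.mem_filter.1 (Finset.eq_univ_iff_forall.1 huniv i)).2

/-- Some argument is `true` iff the number of ones is nonzero. [folklore] -/
theorem exists_eq_true_iff_numOnes_ne_zero {k : ℕ} (v : Fin k → Bool) :
    (∃ i, v i = true) ↔ numOnes v ≠ 0 := by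
  unfold numOnes
  rw [Finset.card_ne_zero, Finset.filter_nonempty_iff]
  simp

/-- On one argument, the number of ones is the argument. [folklore] -/
theorem numOnes_fin_one (v : Fin 1 → Bool) : numOnes v = (v 0).toNat := by
  unfold numOnes
  rw [Finset.univ_unique, Fin.default_eq_zero, Finset.filter_singleton]
  cases v 0 <;> simp

/-- `∧ₖ` is symmetric (Anderson–Dawar 2017, §2.2: the standard basis consists of symmetric
functions). [cite: AndersonDawar2016, §2.2] -/
theorem isSymmetric_and (k : ℕ) : (GateFn.and k).IsSymmetric := fun v w h => by
  show decide (∀ i, v i = true) = decide (∀ i, w i = true)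
  rw [decide_eq_decide, forall_eq_true_iff_numOnes_eq, forall_eq_true_iff_numOnes_eq, h]

/-- `∨ₖ` is symmetric (Anderson–Dawar 2017, §2.2). [cite: AndersonDawar2016, §2.2] -/
theorem isSymmetric_or (k : ℕ) : (GateFn.or k).IsSymmetric := fun v w h => by
  show decide (∃ i, v i = true) = decide (∃ i, w i = true)
  rw [decide_eq_decide, exists_eq_true_iff_numOnes_ne_zero, exists_eq_true_iff_numOnes_ne_zero, h]

/-- `¬` is symmetric (Anderson–Dawar 2017, §2.2). [cite: AndersonDawar2016, §2.2] -/
theorem isSymmetric_not : GateFn.not.IsSymmetric := by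
  rintro (v : Fin 1 → Bool) (w : Fin 1 → Bool) (h : numOnes v = numOnes w)
  rw [numOnes_fin_one, numOnes_fin_one] at h
  show (!v 0) = !w 0
  cases hv : v 0 <;> cases hw : w 0 <;> simp_all

/-- The identity gate is symmetric. [folklore] -/
theorem isSymmetric_id : GateFn.id.IsSymmetric := by
  rintro (v : Fin 1 → Bool) (w : Fin 1 → Bool) (h : numOnes v = numOnes w)
  rw [numOnes_fin_one, numOnes_fin_one] at h
  show v 0 = w 0
  cases hv : v 0 <;> cases hw : w 0 <;> simp_all

/-- `MAJₖ` is symmetric (Anderson–Dawar 2017, §2.2: the majority basis). [cite: AndersonDawar2016, §2.2] -/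
theorem isSymmetric_maj (k : ℕ) : (GateFn.maj k).IsSymmetric :=
  isSymmetric_of_numOnes k fun n => decide (k ≤ 2 * n)

/-- Threshold gates are symmetric. [folklore] -/
theorem isSymmetric_thr (k t : ℕ) : (GateFn.thr k t).IsSymmetric :=
  isSymmetric_of_numOnes k fun n => decide (t ≤ n)

/-- Parity gates are symmetric. [folklore] -/
theorem isSymmetric_xor (k : ℕ) : (GateFn.xor k).IsSymmetric :=
  isSymmetric_of_numOnes k fun n => decide (n % 2 = 1)

/-- Modular counting gates are symmetric. [folklore] -/
theorem isSymmetric_modGate (m k : ℕ) : (GateFn.modGate m k).IsSymmetric :=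
  isSymmetric_of_numOnes k fun n => decide (n % m ≠ 0)

/-- Constant gates are symmetric. [folklore] -/
theorem isSymmetric_const (b : Bool) : (GateFn.const b).IsSymmetric := fun _ _ _ => rfl

end GateFn

/-- Every gate of the unbounded fan-in basis `acBasis = {¬} ∪ {∧ₖ, ∨ₖ}` is symmetric
(Anderson–Dawar 2017, §2.2, "the standard Boolean basis"). [cite: AndersonDawar2016, §2.2] -/
theorem isSymmetric_of_mem_acBasis {f : GateFn} (hf : f ∈ acBasis) : f.IsSymmetric := by
  simp only [acBasis, Set.mem_union, Set.mem_singleton_iff, Set.mem_iUnion,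
    Set.mem_insert_iff] at hf
  rcases hf with rfl | ⟨k, rfl | rfl⟩
  exacts [GateFn.isSymmetric_not, GateFn.isSymmetric_and k, GateFn.isSymmetric_or k]

/-- Every gate of `accBasis m` is symmetric. [folklore] -/
theorem isSymmetric_of_mem_accBasis {m : ℕ} {f : GateFn} (hf : f ∈ accBasis m) :
    f.IsSymmetric := by
  rcases hf with hf | hf
  · exact isSymmetric_of_mem_acBasis hf
  · simp only [Set.mem_iUnion, Set.mem_singleton_iff] at hf
    obtain ⟨k, rfl⟩ := hf
    exact GateFn.isSymmetric_modGate m k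

/-- Every gate of the threshold basis `tcBasis = acBasis ∪ {MAJₖ}` is symmetric
(Anderson–Dawar 2017, §2.2, "the majority basis"). [cite: AndersonDawar2016, §2.2] -/
theorem isSymmetric_of_mem_tcBasis {f : GateFn} (hf : f ∈ tcBasis) : f.IsSymmetric := by
  rcases hf with hf | hf
  · exact isSymmetric_of_mem_acBasis hf
  · simp only [Set.mem_iUnion, Set.mem_singleton_iff] at hf
    obtain ⟨k, rfl⟩ := hf
    exact GateFn.isSymmetric_maj k

/-- Gates with equal, symmetric gate functions take equal values on argument tuples with the same
number of ones (the transport of `GateFn.IsSymmetric` along an equality of gate labels).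
[folklore] -/
theorem Gate.op_eq_op_of_fn_eq {ι : Type*} {g g' : Gate ι} (hfn : g.fn = g'.fn)
    (hg : g'.fn.IsSymmetric) {v : Fin g.arity → Bool} {w : Fin g'.arity → Bool}
    (h : GateFn.numOnes v = GateFn.numOnes w) : g.op v = g'.op w := by
  obtain ⟨k, op, args⟩ := g
  obtain ⟨k', op', args'⟩ := g'
  simp only [Gate.fn, Sigma.mk.inj_iff] at hfn
  obtain ⟨rfl, hop⟩ := hfn
  cases hop
  exact hg v w h

/-! ### Automorphisms of straight-line circuits and symmetry -/

namespace Circuit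

variable {ι : Type*}

/-- The relabelling of gate indices induced by a permutation `σ` of the `n` gates of a program,
extended by the identity to out-of-range indices (which never occur as wires of a well-formed
circuit). [folklore] -/
def relabelGate {n : ℕ} (σ : Equiv.Perm (Fin n)) : ℕ → ℕ :=
  fun k : ℕ => if h : k < n then ((σ ⟨k, h⟩ : Fin n) : ℕ) else k

/-- In range, `relabelGate σ` is `σ`. [folklore] -/
@[simp] theorem relabelGate_of_lt {n : ℕ} (σ : Equiv.Perm (Fin n)) {k : ℕ} (h : k < n) :
    relabelGate σ k = σ ⟨k, h⟩ := dif_pos h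

/-- Out of range, `relabelGate σ` is the identity. [folklore] -/
theorem relabelGate_of_le {n : ℕ} (σ : Equiv.Perm (Fin n)) {k : ℕ} (h : n ≤ k) :
    relabelGate σ k = k := dif_neg (Nat.not_lt.2 h)

/-- `relabelGate σ` maps indices `< n` to indices `< n`. [folklore] -/
theorem relabelGate_lt {n : ℕ} (σ : Equiv.Perm (Fin n)) {k : ℕ} (h : k < n) :
    relabelGate σ k < n := by
  rw [relabelGate_of_lt σ h]
  exact (σ ⟨k, h⟩).2

/-- The relabelling of wires induced by a map `π` of the input variables and a permutation `σ`
of the gates: input wire `i ↦ π i`, gate wire `m ↦ σ m` (Anderson–Dawar 2017, Def. 6: a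
permutation of the universe together with a bijection of the gates). [cite: AndersonDawar2016, Def. 6] -/
def relabelWire (π : ι → ι) {n : ℕ} (σ : Equiv.Perm (Fin n)) : ι ⊕ ℕ → ι ⊕ ℕ :=
  Sum.map π (relabelGate σ)

/-- `relabelWire` on an input wire. [folklore] -/
@[simp] theorem relabelWire_inl (π : ι → ι) {n : ℕ} (σ : Equiv.Perm (Fin n)) (i : ι) :
    relabelWire π σ (Sum.inl i) = Sum.inl (π i) := rfl

/-- `relabelWire` on a gate wire. [folklore] -/
@[simp] theorem relabelWire_inr (π : ι → ι) {n : ℕ} (σ : Equiv.Perm (Fin n)) (m : ℕ) :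
    relabelWire π σ (Sum.inr m) = Sum.inr (relabelGate σ m) := rfl

/-- **Induced automorphism** of a straight-line circuit (Anderson–Dawar 2017, Def. 6;
Dawar–Wilsenach 2025, Def. 3.6 "automorphism extending `π`"): the permutation `σ` of the gates of
`C` is an automorphism of `C` extending the map `π` of the input variables if, for the induced
relabelling `F = relabelWire π σ` of wires, (i) the output wire is fixed, `F C.output = C.output`
(`πΩ = Ω` for a Boolean query), and for every gate `j`, (ii) gate `σ j` carries the same gate
function as gate `j` (`Σ(g) = Σ(πg)`), and (iii) the argument list of gate `σ j` is a permutation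
of the `F`-image of the argument list of gate `j` (the multiset of children is mapped onto the
multiset of children: `W(h,g)` iff `W(πh,πg)`, and relational labels `σΛ(g) = Λ(πg)`, inputs
being wires here). [cite: AndersonDawar2016, Def. 6] -/
def IsInducedAut (C : Circuit ι) (π : ι → ι) (σ : Equiv.Perm (Fin C.gates.length)) : Prop :=
  relabelWire π σ C.output = C.output ∧
    ∀ j : Fin C.gates.length, (C.gates[σ j]).fn = (C.gates[j]).fn ∧
      (List.ofFn (C.gates[σ j]).args).Perm ((List.ofFn (C.gates[j]).args).map (relabelWire π σ))

/-- **`Γ`-symmetric circuit**, the group acting on the input variables themselves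
(Dawar–Wilsenach 2025, Def. 3.7: for `Γ ≤ Sym(X)`, "`C` is `Γ`-symmetric if the action of every
`π ∈ Γ` on `X` extends to an automorphism of `C`"). Stated for any set `Γ` of permutations; the
sources take `Γ` a subgroup. [cite: DawarWilsenach2025, Def. 3.7] -/
def IsVarSymmetric (Γ : Set (Equiv.Perm ι)) (C : Circuit ι) : Prop :=
  ∀ π ∈ Γ, ∃ σ : Equiv.Perm (Fin C.gates.length), C.IsInducedAut π σ

/-- **`Γ`-symmetric circuit on matrix inputs** (Anderson–Dawar 2017, Def. 7, relativised from
`Sym_m` to a set `Γ` of permutations of `Fin m` as in Dawar–Wilsenach 2025, Def. 3.7; the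
"square-symmetric" case of Dawar–Wilsenach, §3.2): the inputs of `C` are the entries `(u, v)` of an
`m × m` Boolean matrix, `ρ ∈ Γ` acts on them diagonally by `(u, v) ↦ (ρ u, ρ v)`, and `C` is
`Γ`-symmetric if every `ρ ∈ Γ` so acting extends to an automorphism of `C`. This is verbatim the
inline predicate `Sym m Γ C` of the route `PneNP/SymmetryBudget` (`isSymmetricUnder_iff`).
Rigidity is NOT required (see `Circuit.IsRigid`). [cite: AndersonDawar2016, Def. 7] -/
def IsSymmetricUnder {m : ℕ} (Γ : Set (Equiv.Perm (Fin m))) (C : Circuit (Fin m × Fin m)) :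
    Prop :=
  ∀ ρ ∈ Γ, ∃ σ : Equiv.Perm (Fin C.gates.length),
    C.IsInducedAut (fun q : Fin m × Fin m => (ρ q.1, ρ q.2)) σ

/-- `Circuit.IsSymmetricUnder` unfolds, by `Iff.rfl`, to the inline predicate `Sym` of the route
`Summits/PneNP/PneNP/Theses/SymmetryBudget.lean` (so its items can be re-signed over the named
predicate without change of meaning). [cite: AndersonDawar2016, Def. 6–7] -/
theorem isSymmetricUnder_iff {m : ℕ} (Γ : Set (Equiv.Perm (Fin m)))
    (C : Circuit (Fin m × Fin m)) :
    C.IsSymmetricUnder Γ ↔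
      ∀ ρ ∈ Γ, ∃ σ : Equiv.Perm (Fin C.gates.length),
        Sum.map (fun q : Fin m × Fin m => (ρ q.1, ρ q.2))
            (fun k : ℕ => if h : k < C.gates.length then ((σ ⟨k, h⟩ : Fin C.gates.length) : ℕ)
              else k) C.output = C.output ∧
          ∀ j : Fin C.gates.length, (C.gates[σ j]).fn = (C.gates[j]).fn ∧
            (List.ofFn (C.gates[σ j]).args).Perm ((List.ofFn (C.gates[j]).args).map
              (Sum.map (fun q : Fin m × Fin m => (ρ q.1, ρ q.2))
                (fun k : ℕ => if h : k < C.gates.length then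
                  ((σ ⟨k, h⟩ : Fin C.gates.length) : ℕ) else k))) :=
  Iff.rfl

/-- The matrix case is the variable case for the diagonal image of `Γ` in `Sym(Fin m × Fin m)`,
`ρ ↦ ρ × ρ` (Dawar–Wilsenach 2025, §3.1–3.2: square-symmetric = symmetric under the image of
`Sym(V)` in its natural action on `V × V`). [cite: DawarWilsenach2025, Def. 3.4 and §3.2] -/
theorem isSymmetricUnder_iff_isVarSymmetric_image {m : ℕ} (Γ : Set (Equiv.Perm (Fin m)))
    (C : Circuit (Fin m × Fin m)) :
    C.IsSymmetricUnder Γ ↔ C.IsVarSymmetric ((fun ρ => Equiv.prodCongr ρ ρ) '' Γ) := by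
  simp only [IsSymmetricUnder, IsVarSymmetric, Set.forall_mem_image]
  exact Iff.rfl

/-- Symmetry is antitone in the set of permutations. [folklore] -/
theorem IsSymmetricUnder.mono {m : ℕ} {Γ Γ' : Set (Equiv.Perm (Fin m))}
    {C : Circuit (Fin m × Fin m)} (h : C.IsSymmetricUnder Γ) (hΓ : Γ' ⊆ Γ) :
    C.IsSymmetricUnder Γ' := fun ρ hρ => h ρ (hΓ hρ)

/-- Symmetry in the variable form is antitone in the set of permutations. [folklore] -/
theorem IsVarSymmetric.mono {Γ Γ' : Set (Equiv.Perm ι)} {C : Circuit ι}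
    (h : C.IsVarSymmetric Γ) (hΓ : Γ' ⊆ Γ) : C.IsVarSymmetric Γ' := fun π hπ => h π (hΓ hπ)

/-- The identity permutation of the gates is an automorphism extending the identity on the
variables. [folklore] -/
theorem isInducedAut_id_one (C : Circuit ι) : C.IsInducedAut _root_.id 1 := by
  have hF : relabelWire (_root_.id : ι → ι) (1 : Equiv.Perm (Fin C.gates.length)) = _root_.id := by
    funext w
    cases w with
    | inl i => rfl
    | inr k =>
      simp only [relabelWire_inr, id_eq, Sum.inr.injEq]
      by_cases hk : k < C.gates.length
      · rw [relabelGate_of_lt _ hk]; rfl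
      · exact relabelGate_of_le _ (Nat.not_lt.1 hk)
  refine ⟨by rw [hF]; rfl, fun j => ⟨rfl, ?_⟩⟩
  rw [hF, List.map_id]
  exact List.Perm.refl _

/-- Every circuit is symmetric under the trivial group. [folklore] -/
theorem isSymmetricUnder_one {m : ℕ} (C : Circuit (Fin m × Fin m)) :
    C.IsSymmetricUnder {1} := by
  intro ρ hρ
  rw [Set.mem_singleton_iff] at hρ
  subst hρ
  exact ⟨1, C.isInducedAut_id_one⟩

/-- **Rigid** circuit (Dawar–Wilsenach 2025, Def. 3.6): every map of the variables has at most
one extension to an automorphism. A separate predicate, not part of symmetry; Anderson–Dawar's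
syntactic rigidity (2017, Def. 8: no two gates with the same label, children and output status)
implies it (their Prop. 9) and is not formalised here. [cite: DawarWilsenach2025, Def. 3.6] -/
def IsRigid (C : Circuit ι) : Prop :=
  ∀ (π : Equiv.Perm ι) (σ σ' : Equiv.Perm (Fin C.gates.length)),
    C.IsInducedAut π σ → C.IsInducedAut π σ' → σ = σ'

/-- The **stabiliser** in `Γ` of gate `j` of a circuit on matrix inputs: the `ρ ∈ Γ` some
automorphism extending which fixes `j` (Anderson–Dawar 2017, §2.2, `Stab(g) = {σ | σg = g}`,
stated there for rigid symmetric circuits, where the automorphism extending `σ` is unique; for a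
rigid circuit (`Circuit.IsRigid`) the two readings agree). [cite: AndersonDawar2016, §2.2] -/
def gateStabiliser {m : ℕ} (Γ : Set (Equiv.Perm (Fin m))) (C : Circuit (Fin m × Fin m))
    (j : Fin C.gates.length) : Set (Equiv.Perm (Fin m)) :=
  {ρ | ρ ∈ Γ ∧ ∃ σ : Equiv.Perm (Fin C.gates.length),
    C.IsInducedAut (fun q : Fin m × Fin m => (ρ q.1, ρ q.2)) σ ∧ σ j = j}

/-- A set `S` of indices **supports** gate `j` (relative to `Γ`) if every `ρ ∈ Γ` fixing `S`
pointwise stabilises `j` (Anderson–Dawar 2017, Def. 11, with `Sym(U)` relativised to `Γ` as in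
Dawar–Wilsenach 2025, Def. 6.1: "`S` is a support of `g` if `Stab(S) ≤ Stab(g)`"; both sources
assume the circuit rigid). [cite: AndersonDawar2016, Def. 11] -/
def Supports {m : ℕ} (Γ : Set (Equiv.Perm (Fin m))) (C : Circuit (Fin m × Fin m))
    (S : Set (Fin m)) (j : Fin C.gates.length) : Prop :=
  ∀ ρ ∈ Γ, (∀ i ∈ S, ρ i = i) → ρ ∈ C.gateStabiliser Γ j

/-- The stabiliser of a gate lies in `Γ`. [folklore] -/
theorem gateStabiliser_subset {m : ℕ} (Γ : Set (Equiv.Perm (Fin m)))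
    (C : Circuit (Fin m × Fin m)) (j : Fin C.gates.length) : C.gateStabiliser Γ j ⊆ Γ :=
  fun _ h => h.1

/-- Supports are upward closed. [folklore] -/
theorem Supports.mono {m : ℕ} {Γ : Set (Equiv.Perm (Fin m))} {C : Circuit (Fin m × Fin m)}
    {S S' : Set (Fin m)} {j : Fin C.gates.length} (h : C.Supports Γ S j) (hS : S ⊆ S') :
    C.Supports Γ S' j :=
  fun ρ hρ hfix => h ρ hρ fun i hi => hfix i (hS hi)

/-- The whole index set supports every gate, provided `1 ∈ Γ` (a permutation fixing every point
is the identity, which extends to the identity automorphism). [folklore] -/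
theorem supports_univ {m : ℕ} {Γ : Set (Equiv.Perm (Fin m))} (hΓ : (1 : Equiv.Perm (Fin m)) ∈ Γ)
    (C : Circuit (Fin m × Fin m)) (j : Fin C.gates.length) : C.Supports Γ Set.univ j := by
  intro ρ _ hfix
  have hρ1 : ρ = 1 := Equiv.ext fun i => hfix i (Set.mem_univ i)
  subst hρ1
  exact ⟨hΓ, 1, C.isInducedAut_id_one, rfl⟩

/-! ### Symmetry implies invariance -/

section Invariance

/-- The number of `true` values read off a tuple of wires is a count over the list of wires.
[folklore] -/
theorem numOnes_eq_countP_ofFn {W : Type*} (u : W → Bool) :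
    ∀ {k : ℕ} (a : Fin k → W),
      GateFn.numOnes (fun i => u (a i)) = (List.ofFn a).countP (fun w => u w)
  | 0, a => by simp [GateFn.numOnes]
  | k + 1, a => by
    have ih := numOnes_eq_countP_ofFn u (fun i => a i.succ)
    unfold GateFn.numOnes at ih ⊢
    rw [Finset.card_filter] at ih ⊢
    rw [Fin.sum_univ_succ, List.ofFn_succ, List.countP_cons, ← ih]
    exact add_comm _ _

/-- Reading permutation-related, relabelled wire tuples through value assignments that agree
along the relabelling gives the same number of ones. [folklore] -/
theorem numOnes_eq_of_perm_map {W : Type*} {k k' : ℕ} {a : Fin k → W} {a' : Fin k' → W}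
    {F : W → W} (hp : (List.ofFn a).Perm ((List.ofFn a').map F)) {u u' : W → Bool}
    (hu : ∀ i, u (F (a' i)) = u' (a' i)) :
    GateFn.numOnes (fun i => u (a i)) = GateFn.numOnes (fun i => u' (a' i)) := by
  rw [numOnes_eq_countP_ofFn u a, numOnes_eq_countP_ofFn u' a', hp.countP_eq, List.countP_map]
  refine List.countP_congr fun w hw => ?_
  obtain ⟨i, rfl⟩ := List.mem_ofFn.1 hw
  rw [Function.comp_apply, hu i]

/-- **The value of gate `σ j` on `x` is the value of gate `j` on `x ∘ π`**, for an automorphism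
`σ` extending `π` of a circuit all of whose gates are symmetric (the inductive heart of
"symmetry implies invariance", Anderson–Dawar 2017, §2.2; induction along the program order).
[cite: AndersonDawar2016, §2.2] -/
theorem IsInducedAut.getD_transcript_eq {C : Circuit ι} {π : ι → ι}
    {σ : Equiv.Perm (Fin C.gates.length)} (h : C.IsInducedAut π σ)
    (hsym : ∀ g ∈ C.gates, g.fn.IsSymmetric) (x : ι → Bool) :
    ∀ (j : ℕ) (hj : j < C.gates.length),
      (transcript x [] C.gates).getD (σ ⟨j, hj⟩) false =
        (transcript (fun i => x (π i)) [] C.gates).getD j false := by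
  intro j
  induction j using Nat.strong_induction_on with
  | _ j ih =>
    intro hj
    obtain ⟨hfn, hperm⟩ := h.2 ⟨j, hj⟩
    simp only [Fin.getElem_fin] at hfn hperm
    rw [getD_transcript_eq_gateValue C x _ (σ ⟨j, hj⟩).2, getD_transcript_eq_gateValue C _ j hj,
      gateValue, gateValue]
    refine Gate.op_eq_op_of_fn_eq hfn (hsym _ (List.getElem_mem hj)) (numOnes_eq_of_perm_map hperm ?_)
    intro a
    cases ha : (C.gates[j]).args a with
    | inl i => rfl
    | inr k =>
      have hk : k < j := C.wf j hj a k ha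
      rw [relabelWire_inr, relabelGate_of_lt σ (hk.trans hj)]
      exact ih k hk (hk.trans hj)

/-- **Symmetry implies invariance** (Anderson–Dawar 2017, §2.2, "an examination of the
definitions suffices to show that symmetry implies invariance"; Dawar–Wilsenach 2025, after
Def. 3.7): if the gate permutation `σ` is an automorphism of `C` extending the map `π` of the
variables and every gate of `C` is a symmetric gate function, then `C` takes the same value on
`x ∘ π` and on `x`. [cite: AndersonDawar2016, §2.2] -/
theorem IsInducedAut.eval_comp_eq {C : Circuit ι} {π : ι → ι}
    {σ : Equiv.Perm (Fin C.gates.length)} (h : C.IsInducedAut π σ)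
    (hsym : ∀ g ∈ C.gates, g.fn.IsSymmetric) (x : ι → Bool) :
    C.eval (fun i => x (π i)) = C.eval x := by
  rw [eval_eq_wireVal, eval_eq_wireVal]
  have hout := h.1
  cases hC : C.output with
  | inl i =>
    rw [hC, relabelWire_inl, Sum.inl.injEq] at hout
    show x (π i) = x i
    rw [hout]
  | inr k =>
    have hk : k < C.gates.length := C.wf_output k hC
    rw [hC, relabelWire_inr, Sum.inr.injEq, relabelGate_of_lt σ hk] at hout
    show (transcript (fun i => x (π i)) [] C.gates).getD k false =
      (transcript x [] C.gates).getD k false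
    rw [← h.getD_transcript_eq hsym x k hk, hout]

/-- A circuit symmetric under `Γ` acting on its variables, all of whose gates are symmetric gate
functions, computes a `Γ`-invariant function (Dawar–Wilsenach 2025, after Def. 3.7: "if a circuit
is `Γ`-symmetric then it computes a `Γ`-symmetric … function"). [cite: DawarWilsenach2025, §3.2] -/
theorem IsVarSymmetric.eval_comp_eq {Γ : Set (Equiv.Perm ι)} {C : Circuit ι}
    (h : C.IsVarSymmetric Γ) (hsym : ∀ g ∈ C.gates, g.fn.IsSymmetric) {π : Equiv.Perm ι}
    (hπ : π ∈ Γ) (x : ι → Bool) : C.eval (fun i => x (π i)) = C.eval x := by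
  obtain ⟨σ, hσ⟩ := h π hπ
  exact hσ.eval_comp_eq hsym x

/-- **A `Γ`-symmetric circuit on matrix inputs with symmetric gates computes a `Γ`-invariant
function of the matrix**: `C (x ∘ (ρ × ρ)) = C x` for `ρ ∈ Γ` (Anderson–Dawar 2017, §2.2).
[cite: AndersonDawar2016, §2.2] -/
theorem IsSymmetricUnder.eval_comp_eq {m : ℕ} {Γ : Set (Equiv.Perm (Fin m))}
    {C : Circuit (Fin m × Fin m)} (h : C.IsSymmetricUnder Γ)
    (hsym : ∀ g ∈ C.gates, g.fn.IsSymmetric) {ρ : Equiv.Perm (Fin m)} (hρ : ρ ∈ Γ)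
    (x : Fin m × Fin m → Bool) :
    C.eval (fun q : Fin m × Fin m => x (ρ q.1, ρ q.2)) = C.eval x := by
  obtain ⟨σ, hσ⟩ := h ρ hρ
  exact hσ.eval_comp_eq hsym x

/-- In particular over the threshold basis: a `Γ`-symmetric `tcBasis`-circuit computing `f`
forces `f` to be `Γ`-invariant, `f (x ∘ (ρ × ρ)) = f x` (Anderson–Dawar 2017, §2.2).
[cite: AndersonDawar2016, §2.2] -/
theorem IsSymmetricUnder.invariant_of_computes {m : ℕ} {Γ : Set (Equiv.Perm (Fin m))}
    {C : Circuit (Fin m × Fin m)} (h : C.IsSymmetricUnder Γ) (hB : C.IsOver tcBasis)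
    {f : (Fin m × Fin m → Bool) → Bool} (hf : C.Computes f) {ρ : Equiv.Perm (Fin m)}
    (hρ : ρ ∈ Γ) (x : Fin m × Fin m → Bool) :
    f (fun q : Fin m × Fin m => x (ρ q.1, ρ q.2)) = f x := by
  rw [← hf, ← hf]
  exact h.eval_comp_eq (fun g hg => isSymmetric_of_mem_tcBasis (hB g hg)) hρ x

end Invariance

/-! ### A symmetric circuit: one gate reading every input -/

section Single

/-- The one-gate circuit applying the gate function `f`, of arity `|ι|`, to ALL input variables
read through an enumeration `e : Fin f.1 ≃ ι` (e.g. the `∧` or `MAJ` of all entries of a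
matrix): the simplest symmetric circuits. [folklore] -/
def single (f : GateFn) (e : Fin f.1 ≃ ι) : Circuit ι where
  gates := [⟨f.1, f.2, fun a => Sum.inl (e a)⟩]
  output := .inr 0
  wf j hj a k hk := by
    simp only [List.length_singleton, Nat.lt_one_iff] at hj
    subst hj
    simp at hk
  wf_output k hk := by cases hk; simp

/-- `single f e` has one gate. [folklore] -/
@[simp] theorem size_single (f : GateFn) (e : Fin f.1 ≃ ι) : (single f e).size = 1 := rfl

/-- `single f e` is a circuit over any basis containing `f`. [folklore] -/
theorem single_isOver {B : Set GateFn} {f : GateFn} (hf : f ∈ B) (e : Fin f.1 ≃ ι) :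
    (single f e).IsOver B := by
  intro g hg
  simp only [single, List.mem_singleton] at hg
  subst hg
  exact hf

/-- `single f e` computes `x ↦ f (x ∘ e)`. [folklore] -/
theorem eval_single (f : GateFn) (e : Fin f.1 ≃ ι) (x : ι → Bool) :
    (single f e).eval x = f.2 (fun a => x (e a)) := by
  rw [eval_eq_wireVal]
  show (transcript x [] (single f e).gates).getD 0 false = _
  rw [getD_transcript_eq_gateValue _ x 0 (by simp [single])]
  rfl

/-- **The one-gate circuit reading every input is symmetric under EVERY permutation of the
variables**: the identity on its single gate is an automorphism extending any `π`, because the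
argument list enumerates all variables and `π` merely permutes that enumeration (non-vacuity of
`IsVarSymmetric`). [folklore] -/
theorem single_isVarSymmetric_univ (f : GateFn) (e : Fin f.1 ≃ ι) :
    (single f e).IsVarSymmetric Set.univ := by
  intro π _
  refine ⟨1, ?_, ?_⟩
  · show Sum.inr (relabelGate (1 : Equiv.Perm (Fin 1)) 0) = Sum.inr 0
    rw [relabelGate_of_lt _ Nat.one_pos]
    rfl
  · intro j
    obtain ⟨j, hj⟩ := j
    have hj0 : j = 0 := by
      simp only [single, List.length_singleton] at hj
      omega
    subst hj0
    refine ⟨rfl, ?_⟩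
    show (List.ofFn fun a : Fin f.1 => (Sum.inl (e a) : ι ⊕ ℕ)).Perm
      ((List.ofFn fun a : Fin f.1 => (Sum.inl (e a) : ι ⊕ ℕ)).map
        (relabelWire π (1 : Equiv.Perm (Fin 1))))
    rw [List.map_ofFn]
    refine List.Perm.symm ?_
    convert Equiv.Perm.ofFn_comp_perm (e.trans (π.trans e.symm))
      (fun a : Fin f.1 => (Sum.inl (e a) : ι ⊕ ℕ)) using 2
    funext a
    simp only [Function.comp_apply, Equiv.trans_apply, Equiv.apply_symm_apply, relabelWire_inl]

/-- On matrix inputs, the one-gate circuit reading every entry is symmetric under every set of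
permutations of `Fin m` (non-vacuity of `IsSymmetricUnder`). [folklore] -/
theorem single_isSymmetricUnder {m : ℕ} (f : GateFn) (e : Fin f.1 ≃ Fin m × Fin m)
    (Γ : Set (Equiv.Perm (Fin m))) : (single f e).IsSymmetricUnder Γ := by
  rw [isSymmetricUnder_iff_isVarSymmetric_image]
  exact (single_isVarSymmetric_univ f e).mono (Set.subset_univ _)

end Single

end Circuit

/-! ### Symmetric circuit complexity and the symmetry budget -/

/-- `HasSymCircuit B Γ s f`: some `Γ`-symmetric circuit over the basis `B` with at most `s` gates
computes `f : (Fin m × Fin m → Bool) → Bool` (the inline `HasSym` of the route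
`PneNP/SymmetryBudget`, with `B = tcBasis` there; Anderson–Dawar 2017, §2.2, symmetric
circuit families of polynomial size). [cite: AndersonDawar2016, Def. 7] -/
def HasSymCircuit {m : ℕ} (B : Set GateFn) (Γ : Set (Equiv.Perm (Fin m))) (s : ℕ)
    (f : (Fin m × Fin m → Bool) → Bool) : Prop :=
  ∃ C : Circuit (Fin m × Fin m), C.IsOver B ∧ C.size ≤ s ∧ C.IsSymmetricUnder Γ ∧ C.Computes f

/-- The **symmetric circuit complexity** of `f` over the basis `B` and the set of permutations
`Γ`: the least size of a `Γ`-symmetric circuit over `B` computing `f` (Anderson–Dawar 2017, §2,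
size of symmetric circuits). **Junk value `0`** if no `Γ`-symmetric circuit over `B` computes `f`
(e.g. when `f` is not `Γ`-invariant and `B ⊆ tcBasis`, by
`Circuit.IsSymmetricUnder.invariant_of_computes`), exactly as for `circuitSizeOver`.
[cite: AndersonDawar2016, Def. 7] -/
noncomputable def symCircuitSizeOver {m : ℕ} (B : Set GateFn) (Γ : Set (Equiv.Perm (Fin m)))
    (f : (Fin m × Fin m → Bool) → Bool) : ℕ :=
  sInf {s | ∃ C : Circuit (Fin m × Fin m), C.IsOver B ∧ C.IsSymmetricUnder Γ ∧ C.Computes f ∧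
    C.size = s}

/-- Any `Γ`-symmetric circuit over `B` computing `f` bounds the symmetric circuit complexity.
[folklore] -/
theorem symCircuitSizeOver_le_of_computes {m : ℕ} {B : Set GateFn} {Γ : Set (Equiv.Perm (Fin m))}
    {f : (Fin m × Fin m → Bool) → Bool} (C : Circuit (Fin m × Fin m)) (hB : C.IsOver B)
    (hΓ : C.IsSymmetricUnder Γ) (hf : C.Computes f) : symCircuitSizeOver B Γ f ≤ C.size :=
  Nat.sInf_le ⟨C, hB, hΓ, hf, rfl⟩

/-- `HasSymCircuit` at the optimal size, when some symmetric circuit exists. [folklore] -/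
theorem hasSymCircuit_symCircuitSizeOver {m : ℕ} {B : Set GateFn} {Γ : Set (Equiv.Perm (Fin m))}
    {f : (Fin m × Fin m → Bool) → Bool}
    (h : ∃ C : Circuit (Fin m × Fin m), C.IsOver B ∧ C.IsSymmetricUnder Γ ∧ C.Computes f) :
    HasSymCircuit B Γ (symCircuitSizeOver B Γ f) f := by
  obtain ⟨C, hB, hΓ, hf⟩ := h
  have hne : {s | ∃ C : Circuit (Fin m × Fin m), C.IsOver B ∧ C.IsSymmetricUnder Γ ∧
      C.Computes f ∧ C.size = s}.Nonempty := ⟨C.size, C, hB, hΓ, hf, rfl⟩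
  obtain ⟨C', hB', hΓ', hf', hs⟩ := Nat.sInf_mem hne
  exact ⟨C', hB', hs.le, hΓ', hf'⟩

/-- A symmetric circuit of size `≤ s` witnesses `HasSymCircuit`, monotonically in `s`. [folklore] -/
theorem HasSymCircuit.mono {m : ℕ} {B : Set GateFn} {Γ : Set (Equiv.Perm (Fin m))} {s s' : ℕ}
    {f : (Fin m × Fin m → Bool) → Bool} (h : HasSymCircuit B Γ s f) (hs : s ≤ s') :
    HasSymCircuit B Γ s' f := by
  obtain ⟨C, hB, hC, hΓ, hf⟩ := h
  exact ⟨C, hB, hC.trans hs, hΓ, hf⟩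

/-- **Non-vacuity**: a gate `f ∈ B` applied to all `m²` entries (e.g. `∧_{m²}`, `MAJ_{m²}` for
`B = tcBasis`) is computed by a `Γ`-symmetric circuit over `B` of size `1`, for every `Γ`.
[folklore] -/
theorem hasSymCircuit_single {m : ℕ} {B : Set GateFn} {f : GateFn} (hf : f ∈ B)
    (e : Fin f.1 ≃ Fin m × Fin m) (Γ : Set (Equiv.Perm (Fin m))) :
    HasSymCircuit B Γ 1 (fun x => f.2 fun a => x (e a)) :=
  ⟨Circuit.single f e, Circuit.single_isOver hf e, le_rfl, Circuit.single_isSymmetricUnder f e Γ,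
    Circuit.eval_single f e⟩

/-- Hence the `∧` of all entries has symmetric circuit complexity at most `1` over `tcBasis`, under
any `Γ` (so `symCircuitSizeOver` is not always the junk `0`-or-nothing). [folklore] -/
theorem symCircuitSizeOver_and_le_one {m : ℕ} (Γ : Set (Equiv.Perm (Fin m)))
    (e : Fin (m * m) ≃ Fin m × Fin m) :
    symCircuitSizeOver tcBasis Γ (fun x => (GateFn.and (m * m)).2 fun a => x (e a)) ≤ 1 :=
  symCircuitSizeOver_le_of_computes (Circuit.single (GateFn.and (m * m)) e)
    (Circuit.single_isOver (acBasis_subset_tcBasis (Or.inr (Set.mem_iUnion.2 ⟨_, Or.inl rfl⟩))) e)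
    (Circuit.single_isSymmetricUnder (GateFn.and (m * m)) e Γ)
    (Circuit.eval_single (GateFn.and (m * m)) e)

/-- The **symmetry budget** `Bud(m, g)`: the permutations of `Fin m` fixing every point `i` with
`i + g < m`, i.e. the pointwise stabiliser of the first `m - g` points (only the last `g` points
move). Verbatim the inline `Bud` of the route `PneNP/SymmetryBudget`; the pointwise stabiliser
of a set is Anderson–Dawar's `Stab` (2017, §2.2). [cite: AndersonDawar2016, §2.2] -/
def pointStabiliserBudget (m g : ℕ) : Set (Equiv.Perm (Fin m)) :=
  {ρ | ∀ i : Fin m, (i : ℕ) + g < m → ρ i = i}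

/-- Membership in the budget, unfolded. [folklore] -/
@[simp] theorem mem_pointStabiliserBudget_iff {m g : ℕ} (ρ : Equiv.Perm (Fin m)) :
    ρ ∈ pointStabiliserBudget m g ↔ ∀ i : Fin m, (i : ℕ) + g < m → ρ i = i := Iff.rfl

/-- The symmetry budget as a subgroup of `Sym(Fin m)` (a pointwise stabiliser is a subgroup).
[folklore] -/
def budgetSubgroup (m g : ℕ) : Subgroup (Equiv.Perm (Fin m)) where
  carrier := pointStabiliserBudget m g
  mul_mem' {ρ τ} hρ hτ i hi := by
    show ρ (τ i) = i
    rw [hτ i hi, hρ i hi]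
  one_mem' _ _ := rfl
  inv_mem' {ρ} hρ i hi := by
    show ρ.symm i = i
    conv_lhs => rw [← hρ i hi]
    exact ρ.symm_apply_apply i

/-- The carrier of `budgetSubgroup m g` is `pointStabiliserBudget m g`. [folklore] -/
@[simp] theorem coe_budgetSubgroup (m g : ℕ) :
    (budgetSubgroup m g : Set (Equiv.Perm (Fin m))) = pointStabiliserBudget m g := rfl

/-- With budget `g = 0` only the identity remains. [folklore] -/
theorem pointStabiliserBudget_zero (m : ℕ) : pointStabiliserBudget m 0 = {1} := by
  ext ρ
  simp only [mem_pointStabiliserBudget_iff, add_zero, Set.mem_singleton_iff]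
  exact ⟨fun h => Equiv.ext fun i => h i i.2, fun h i _ => by rw [h]; rfl⟩

/-- With budget `g ≥ m` every permutation is allowed. [folklore] -/
theorem pointStabiliserBudget_of_le {m g : ℕ} (h : m ≤ g) : pointStabiliserBudget m g = Set.univ :=
  Set.eq_univ_of_forall fun _ i hi => absurd hi (by omega)

/-- The budget is monotone in `g`. [folklore] -/
theorem pointStabiliserBudget_mono (m : ℕ) {g g' : ℕ} (h : g ≤ g') :
    pointStabiliserBudget m g ⊆ pointStabiliserBudget m g' :=
  fun _ hρ i hi => hρ i (by omega)

/-! ### Bundled symmetric circuits -/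

/-- A **`Γ`-symmetric circuit over the basis `B`** on `m × m` matrix inputs, bundled: a
straight-line circuit whose gates are drawn from `B` and which admits, for every `ρ ∈ Γ`, an
automorphism extending the diagonal action `(u, v) ↦ (ρ u, ρ v)` of `ρ` on the inputs
(Anderson–Dawar 2017, Def. 7, relativised to `Γ` as in Dawar–Wilsenach 2025, Def. 3.7). The
unbundled predicate is `Circuit.IsSymmetricUnder`; `HasSymCircuit` in bundled form is
`hasSymCircuit_iff`. [cite: AndersonDawar2016, Def. 7] -/
structure SymmetricCircuit (m : ℕ) (B : Set GateFn) (Γ : Set (Equiv.Perm (Fin m))) where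
  /-- The underlying straight-line circuit on `m × m` matrix inputs. -/
  circuit : Circuit (Fin m × Fin m)
  /-- Its gates are drawn from the basis `B`. -/
  isOver : circuit.IsOver B
  /-- Every `ρ ∈ Γ`, acting diagonally on the inputs, extends to an automorphism. -/
  symmetric : circuit.IsSymmetricUnder Γ

namespace SymmetricCircuit

variable {m : ℕ} {B : Set GateFn} {Γ : Set (Equiv.Perm (Fin m))}

/-- The size (number of gates) of a symmetric circuit (Anderson–Dawar 2017, Def. 4: `|C| = |G|`).
[cite: AndersonDawar2016, Def. 4] -/
def size (S : SymmetricCircuit m B Γ) : ℕ := S.circuit.size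

/-- The size of a bundled symmetric circuit is the size of its circuit. [folklore] -/
@[simp] theorem size_eq (S : SymmetricCircuit m B Γ) : S.size = S.circuit.size := rfl

/-- The one-gate symmetric circuit applying `f ∈ B` to every entry (non-vacuity of the bundled
notion, for every `Γ`). [folklore] -/
def single {f : GateFn} (hf : f ∈ B) (e : Fin f.1 ≃ Fin m × Fin m) : SymmetricCircuit m B Γ :=
  ⟨Circuit.single f e, Circuit.single_isOver hf e, Circuit.single_isSymmetricUnder f e Γ⟩

/-- `single` has one gate. [folklore] -/
@[simp] theorem size_single {f : GateFn} (hf : f ∈ B) (e : Fin f.1 ≃ Fin m × Fin m) :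
    (single (Γ := Γ) hf e).size = 1 := rfl

/-- A symmetric circuit is symmetric under every smaller set of permutations. [folklore] -/
def restrict (S : SymmetricCircuit m B Γ) {Γ' : Set (Equiv.Perm (Fin m))} (h : Γ' ⊆ Γ) :
    SymmetricCircuit m B Γ' :=
  ⟨S.circuit, S.isOver, S.symmetric.mono h⟩

/-- A symmetric circuit over a basis of symmetric gate functions (e.g. `tcBasis`) computes a
`Γ`-invariant function of the matrix (Anderson–Dawar 2017, §2.2, symmetry implies invariance).
[cite: AndersonDawar2016, §2.2] -/
theorem eval_comp_eq (S : SymmetricCircuit m B Γ) (hB : ∀ f ∈ B, GateFn.IsSymmetric f)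
    {ρ : Equiv.Perm (Fin m)} (hρ : ρ ∈ Γ) (x : Fin m × Fin m → Bool) :
    S.circuit.eval (fun q : Fin m × Fin m => x (ρ q.1, ρ q.2)) = S.circuit.eval x :=
  S.symmetric.eval_comp_eq (fun g hg => hB _ (S.isOver g hg)) hρ x

/-- Over the threshold basis every bundled symmetric circuit computes a `Γ`-invariant function.
[cite: AndersonDawar2016, §2.2] -/
theorem eval_comp_eq_of_tcBasis (S : SymmetricCircuit m tcBasis Γ) {ρ : Equiv.Perm (Fin m)}
    (hρ : ρ ∈ Γ) (x : Fin m × Fin m → Bool) :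
    S.circuit.eval (fun q : Fin m × Fin m => x (ρ q.1, ρ q.2)) = S.circuit.eval x :=
  S.eval_comp_eq (fun _ hf => isSymmetric_of_mem_tcBasis hf) hρ x

end SymmetricCircuit

/-- `HasSymCircuit B Γ s f` in bundled form: some `Γ`-symmetric circuit over `B` of size `≤ s`
computes `f`. [folklore] -/
theorem hasSymCircuit_iff {m : ℕ} {B : Set GateFn} {Γ : Set (Equiv.Perm (Fin m))} {s : ℕ}
    {f : (Fin m × Fin m → Bool) → Bool} :
    HasSymCircuit B Γ s f ↔ ∃ S : SymmetricCircuit m B Γ, S.size ≤ s ∧ S.circuit.Computes f :=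
  ⟨fun ⟨C, hB, hs, hΓ, hf⟩ => ⟨⟨C, hB, hΓ⟩, hs, hf⟩,
    fun ⟨S, hs, hf⟩ => ⟨S.circuit, S.isOver, hs, S.symmetric, hf⟩⟩

end Literature.Computability.Complexity
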